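import Summits.Ventures.HSemireg.ObstructionLocusLocalLemma

/-!
# Venture HSemireg — (S5) OBSTRUCTION LOCUS away from secant type, XV: the BLOCK MODELS `M(S_1, …, S_r)` of a
# (GEN) arrangement — block ideals `I_S` with free coordinates, monomial bookkeeping, standard parts, step A

HONEST FRAMING.  Part of the Lean side of the computation cell `pub-hsemireg` (track «S4-PUSH» (ii), seat s4-prove-2,
files XV–XIX).  Files VIII–X put LEMMA L1 — the local algebra behind the named hypothesis shape (H-arr) of file I —
in the kernel for the ONE-BLOCK model `K_S`, `S = [n]` (every germ of a SINGLE translate `W + t`).  The source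
statement, general-structure/EXT-NOTE.md §6.B(a), is about EVERY block model: at a point `q` of a union
`Z_T = ⋃_{t ∈ T} (W + t)` of `m ≥ 2` torsion translates under (GEN), with `S_t(q) = {k : q_k = t_k}` (pairwise
disjoint), the germ is `(𝔸ⁿ, M(S_1, …, S_r))`, `M = ⋃_s K_{S_s}`, `K_S = ⋃_{a<b ∈ S} V(x_a, x_b)`, with ideal
`I_M = ⋂_s I_{K_{S_s}}`, `I_{K_S} = (x_{S ∖ a} : a ∈ S)`; and 6.B(a) says `Hom_R(I_M, R/I_M) ≅ ⊕_B A_B²` over the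
components `B = V(x_a, x_b)`, `{a, b} ⊂` some block, `A_B = R/(x_a, x_b)` («no poles, no gluing»; on paper: tensor
product of the block resolutions + Künneth; machine check of 3438 multidegrees, deform-ring2).  Files XV–XIX prove
this for every `n`, every family of pairwise disjoint non-empty blocks and every commutative coefficient ring `K`
(no domain hypothesis), WITHOUT a presentation of `I_M`: explicit normal fields + a `V`-scaled branch map per block +
`I_M = ⋂_s I_s` — this file is the bookkeeping layer.  Nothing here constructs a variety or a sheaf; (H-arr)'s GLOBAL
half (Prop. K, the Čech line, completion, (R4)) and (H-NC) stay prose; nothing here says that HC / HC_CM / HC_AV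
holds; no Literature fact is declared or used (only the Stanley–Reisner monomial helpers are imported, via file VIII).

* `ind T = 𝟙_T`, `sq T = ∏_{c ∈ T} x_c = x^{𝟙_T}` and their bookkeeping (`sq_union`, `X_mul_sq_erase`,
  `coeff_sq_mul_add`, `eq_zero_of_sq_mul_eq_zero`, `le_of_mem_support_sq_mul`).
* `blockIdeal K S = (x_{S ∖ a} : a ∈ S)` (`= I_{K_S}·R`, the other coordinates free), `BlockMem S e` («`x^e` has at
  most one zero exponent on `S`»), **`mem_blockIdeal_iff`** (monomial ideal: membership read off the support),
  `blockIdeal_univ` (`S = [n]` is file VIII's `srDesignIdeal`).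
* `stdPart S p` — the STANDARD PART of `p` modulo `blockIdeal K S` (delete the monomials lying in the ideal):
  `coeff_stdPart`, `mk_stdPart`, `stdPart_eq_zero`, `eq_zero_of_std_of_mem`, and the free-coordinate lemmas
  `blockMem_add_iff_of_notMem`, `std_X_mul`.
* **`X_smul_eq_zero_of_forall_X_smul_eq`** — STEP A for a block with free coordinates: if `x_a ν_a = x_b ν_b` in
  `R/I_S` for all `a, b ∈ S`, then every `x_a ν_a = 0`.
The block STRUCTURES `(S_i)_i`, the arrangement ideal `I_M = ⋂_i I_{S_i}` and its test elements are file XVI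
(`ObstructionLocusBlockArrangement.lean`).
References (dictionary only): EXT-NOTE.md §6.0 (local models), §6.A, §6.B(a); G2-REDUCIBLE-POINT-THEOREM.md §2 L1.
-/

open scoped BigOperators
open MvPolynomial Finset
open Literature.AlgebraicGeometry.StanleyReisner (prod_X_eq_monomial_indicator indicator_one_le_iff
  support_indicator_one)

namespace Summit.Ventures.HSemireg.ObstructionLocus.BlockModel

variable {K : Type*} [CommRing K] {n : ℕ}

/-! ## Square-free monomials of a set of coordinates -/

/-- `𝟙_T`, the indicator exponent vector of `T ⊂ [n]`. -/
noncomputable def ind (T : Finset (Fin n)) : Fin n →₀ ℕ := Finsupp.indicator T fun _ _ => 1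

/-- `x_T = ∏_{c ∈ T} x_c`. -/
noncomputable def sq (T : Finset (Fin n)) : MvPolynomial (Fin n) K := ∏ c ∈ T, X c

/-- `x_T` is the monomial `x^{𝟙_T}`. -/
theorem sq_eq_monomial (T : Finset (Fin n)) : (sq T : MvPolynomial (Fin n) K) = monomial (ind T) 1 :=
  prod_X_eq_monomial_indicator K T

/-- `𝟙_T` is `1` on `T`. -/
theorem ind_apply_of_mem {T : Finset (Fin n)} {c : Fin n} (h : c ∈ T) : ind T c = 1 := by
  rw [ind, Finsupp.indicator_apply, dif_pos h]

/-- `𝟙_T` is `0` off `T`. -/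
theorem ind_apply_of_notMem {T : Finset (Fin n)} {c : Fin n} (h : c ∉ T) : ind T c = 0 := by
  rw [ind, Finsupp.indicator_apply, dif_neg h]

/-- `supp 𝟙_T = T`. -/
theorem support_ind (T : Finset (Fin n)) : (ind T).support = T := support_indicator_one T

/-- `𝟙_T ≤ e` iff `T ⊂ supp e`. -/
theorem ind_le_iff {T : Finset (Fin n)} {e : Fin n →₀ ℕ} : ind T ≤ e ↔ T ⊆ e.support := indicator_one_le_iff

/-- `𝟙_{T ∪ T'} = 𝟙_T + 𝟙_{T'}` for disjoint `T, T'`. -/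
theorem ind_union {T T' : Finset (Fin n)} (h : Disjoint T T') : ind (T ∪ T') = ind T + ind T' := by
  ext c
  rw [Finsupp.add_apply]
  by_cases hc : c ∈ T
  · rw [ind_apply_of_mem (mem_union_left _ hc), ind_apply_of_mem hc,
      ind_apply_of_notMem (Finset.disjoint_left.1 h hc)]
  · by_cases hc' : c ∈ T'
    · rw [ind_apply_of_mem (mem_union_right _ hc'), ind_apply_of_notMem hc, ind_apply_of_mem hc']
    · rw [ind_apply_of_notMem (by rw [mem_union]; tauto), ind_apply_of_notMem hc, ind_apply_of_notMem hc']

/-- `𝟙_T = 𝟙_c + 𝟙_{T ∖ c}` for `c ∈ T`. -/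
theorem ind_eq_single_add_erase {T : Finset (Fin n)} {c : Fin n} (h : c ∈ T) :
    ind T = Finsupp.single c 1 + ind (T.erase c) := by
  ext d
  rw [Finsupp.add_apply, Finsupp.single_apply]
  by_cases hd : c = d
  · subst hd
    rw [if_pos rfl, ind_apply_of_mem h, ind_apply_of_notMem (Finset.notMem_erase c T)]
  · rw [if_neg hd, zero_add]
    by_cases hdT : d ∈ T
    · rw [ind_apply_of_mem hdT, ind_apply_of_mem (mem_erase.2 ⟨fun h' => hd h'.symm, hdT⟩)]
    · rw [ind_apply_of_notMem hdT, ind_apply_of_notMem fun h' => hdT (mem_erase.1 h').2]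

/-- `x_{T ∪ T'} = x_T · x_{T'}` for disjoint `T, T'`. -/
theorem sq_union {T T' : Finset (Fin n)} (h : Disjoint T T') :
    (sq (T ∪ T') : MvPolynomial (Fin n) K) = sq T * sq T' :=
  Finset.prod_union h

/-- `x_c · x_{T ∖ c} = x_T` for `c ∈ T`. -/
theorem X_mul_sq_erase {T : Finset (Fin n)} {c : Fin n} (h : c ∈ T) :
    X c * sq (T.erase c) = (sq T : MvPolynomial (Fin n) K) :=
  Finset.mul_prod_erase T (fun l => (X l : MvPolynomial (Fin n) K)) h

/-- The coefficient of `x^{e + 𝟙_T}` in `x_T · p` is the coefficient of `x^e` in `p`. -/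
theorem coeff_sq_mul_add (T : Finset (Fin n)) (p : MvPolynomial (Fin n) K) (e : Fin n →₀ ℕ) :
    coeff (e + ind T) (sq T * p) = coeff e p := by
  rw [sq_eq_monomial, add_comm, coeff_monomial_mul, one_mul]

/-- The coefficients of `x_T · p`. -/
theorem coeff_sq_mul (T : Finset (Fin n)) (p : MvPolynomial (Fin n) K) (e : Fin n →₀ ℕ) :
    coeff e (sq T * p) = if ind T ≤ e then coeff (e - ind T) p else 0 := by
  rw [sq_eq_monomial, coeff_monomial_mul', one_mul]

/-- Multiplication by `x_T` is injective (any commutative coefficient ring). -/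
theorem eq_zero_of_sq_mul_eq_zero {T : Finset (Fin n)} {p : MvPolynomial (Fin n) K} (h : sq T * p = 0) : p = 0 := by
  ext e
  have := congr_arg (coeff (e + ind T)) h
  rwa [coeff_sq_mul_add, coeff_zero] at this

/-- An exponent occurring in `x_T · p` is `𝟙_T` plus an exponent occurring in `p`. -/
theorem le_of_mem_support_sq_mul {T : Finset (Fin n)} {p : MvPolynomial (Fin n) K} {e : Fin n →₀ ℕ}
    (h : e ∈ (sq T * p).support) : ind T ≤ e ∧ e - ind T ∈ p.support := by
  rw [mem_support_iff, coeff_sq_mul] at h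
  by_cases hle : ind T ≤ e
  · rw [if_pos hle] at h
    exact ⟨hle, mem_support_iff.2 h⟩
  · rw [if_neg hle] at h
    exact absurd rfl h

/-- Conversely every exponent of `p`, shifted by `𝟙_T`, occurs in `x_T · p`. -/
theorem add_mem_support_sq_mul {T : Finset (Fin n)} {p : MvPolynomial (Fin n) K} {e : Fin n →₀ ℕ}
    (h : e ∈ p.support) : e + ind T ∈ (sq T * p).support := by
  rw [mem_support_iff, coeff_sq_mul_add]
  exact mem_support_iff.1 h

/-! ## The block ideal `I_S = (x_{S ∖ a} : a ∈ S)` -/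

variable (K) in
/-- The BLOCK IDEAL of `S ⊂ [n]`: `I_S = (x_{S ∖ a} : a ∈ S) = ⋂_{a<b ∈ S} (x_a, x_b)`, the ideal of
`K_S × 𝔸^{[n] ∖ S} ⊂ 𝔸ⁿ` (the coordinates off `S` are free).  For `S = [n]` this is file VIII's `srDesignIdeal`. -/
noncomputable def blockIdeal (S : Finset (Fin n)) : Ideal (MvPolynomial (Fin n) K) :=
  Ideal.span ((fun a => sq (S.erase a)) '' (S : Set (Fin n)))

/-- The monomial membership predicate of `I_S`: `x^e ∈ I_S` iff `e` vanishes at no coordinate of `S` but (at most)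
one — `∃ a ∈ S, S ∖ a ⊂ supp e`. -/
def BlockMem (S : Finset (Fin n)) (e : Fin n →₀ ℕ) : Prop := ∃ a ∈ S, S.erase a ⊆ e.support

/-- `BlockMem` is decidable (finitely many coordinates). -/
instance instDecidableBlockMem (S : Finset (Fin n)) (e : Fin n →₀ ℕ) : Decidable (BlockMem S e) := by
  unfold BlockMem; infer_instance

/-- The generators lie in the block ideal. -/
theorem sq_erase_mem {S : Finset (Fin n)} {a : Fin n} (ha : a ∈ S) : sq (S.erase a) ∈ blockIdeal K S :=
  Ideal.subset_span ⟨a, ha, rfl⟩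

/-- `I_S` in Mathlib's monomial-ideal format. -/
theorem blockIdeal_eq_span_monomial (S : Finset (Fin n)) :
    blockIdeal K S = Ideal.span ((fun e => monomial e (1 : K)) ''
      ((fun a => ind (S.erase a)) '' (S : Set (Fin n)))) := by
  unfold blockIdeal
  congr 1
  ext m
  constructor
  · rintro ⟨a, ha, rfl⟩
    exact ⟨_, ⟨a, ha, rfl⟩, (sq_eq_monomial _).symm⟩
  · rintro ⟨e, ⟨a, ha, rfl⟩, rfl⟩
    exact ⟨a, ha, sq_eq_monomial _⟩

/-- **Membership in `I_S` is read off the monomials.** -/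
theorem mem_blockIdeal_iff {S : Finset (Fin n)} {f : MvPolynomial (Fin n) K} :
    f ∈ blockIdeal K S ↔ ∀ e ∈ f.support, BlockMem S e := by
  rw [blockIdeal_eq_span_monomial, mem_ideal_span_monomial_image]
  refine forall₂_congr fun e _ => ⟨?_, ?_⟩
  · rintro ⟨d, ⟨a, ha, rfl⟩, hle⟩
    exact ⟨a, ha, ind_le_iff.1 hle⟩
  · rintro ⟨a, ha, h⟩
    exact ⟨_, ⟨a, ha, rfl⟩, ind_le_iff.2 h⟩

/-- Consistency with file VIII: the block ideal of `S = [n]` is `srDesignIdeal K n = I_W`. -/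
theorem blockIdeal_univ : blockIdeal K (univ : Finset (Fin n)) = srDesignIdeal K n := by
  unfold blockIdeal srDesignIdeal
  congr 1
  ext m
  simp only [Set.mem_image, Finset.coe_univ, Set.mem_univ, true_and, Set.mem_range]
  exact Iff.rfl

/-- `BlockMem` only depends on the exponents at the coordinates of `S`. -/
theorem blockMem_congr {S : Finset (Fin n)} {e e' : Fin n →₀ ℕ} (h : ∀ c ∈ S, e c = e' c) :
    BlockMem S e ↔ BlockMem S e' := by
  have key : ∀ a c, c ∈ S.erase a → (c ∈ e.support ↔ c ∈ e'.support) := by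
    intro a c hc
    rw [Finsupp.mem_support_iff, Finsupp.mem_support_iff, h c (mem_erase.1 hc).2]
  constructor
  · rintro ⟨a, ha, hs⟩
    exact ⟨a, ha, fun c hc => (key a c hc).1 (hs hc)⟩
  · rintro ⟨a, ha, hs⟩
    exact ⟨a, ha, fun c hc => (key a c hc).2 (hs hc)⟩

/-- Enlarging the support preserves `BlockMem`. -/
theorem blockMem_of_support_subset {S : Finset (Fin n)} {e e' : Fin n →₀ ℕ} (h : e.support ⊆ e'.support)
    (he : BlockMem S e) : BlockMem S e' := by
  obtain ⟨a, ha, hs⟩ := he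
  exact ⟨a, ha, hs.trans h⟩

/-- A free coordinate `c ∉ S` does not affect membership: `x_c x^e ∈ I_S ⟺ x^e ∈ I_S`. -/
theorem blockMem_single_add_iff_of_notMem {S : Finset (Fin n)} {c : Fin n} (hc : c ∉ S) (e : Fin n →₀ ℕ) :
    BlockMem S (Finsupp.single c 1 + e) ↔ BlockMem S e := by
  refine blockMem_congr fun d hd => ?_
  rw [Finsupp.add_apply, Finsupp.single_apply, if_neg, zero_add]
  rintro rfl
  exact hc hd

/-- The same for a free square-free factor `x_T`, `T ∩ S = ∅`. -/
theorem blockMem_add_ind_iff_of_disjoint {S T : Finset (Fin n)} (hT : Disjoint T S) (e : Fin n →₀ ℕ) :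
    BlockMem S (e + ind T) ↔ BlockMem S e := by
  refine blockMem_congr fun d hd => ?_
  rw [Finsupp.add_apply, ind_apply_of_notMem (Finset.disjoint_right.1 hT hd), add_zero]

/-- A monomial whose exponent satisfies `BlockMem` lies in `I_S`. -/
theorem monomial_mem_blockIdeal {S : Finset (Fin n)} {e : Fin n →₀ ℕ} (he : BlockMem S e) (c : K) :
    monomial e c ∈ blockIdeal K S := by
  classical
  rw [mem_blockIdeal_iff]
  intro e' he'
  rw [support_monomial] at he'
  split_ifs at he' with h
  · exact absurd he' (Finset.notMem_empty _)
  · rw [Finset.mem_singleton] at he'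
    exact he' ▸ he

/-- The `R`-action on a quotient ring in terms of representatives. -/
theorem smul_mk_eq (J : Ideal (MvPolynomial (Fin n) K)) (r g : MvPolynomial (Fin n) K) :
    r • Ideal.Quotient.mk J g = Ideal.Quotient.mk J (r * g) := by
  rw [← smul_eq_mul, ← Ideal.Quotient.mk_eq_mk, ← Ideal.Quotient.mk_eq_mk, Submodule.Quotient.mk_smul]

/-! ## The standard part modulo `I_S` -/

/-- The STANDARD PART of `p` modulo `I_S`: delete the monomials of `p` that lie in `I_S`. -/
noncomputable def stdPart (S : Finset (Fin n)) (p : MvPolynomial (Fin n) K) : MvPolynomial (Fin n) K :=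
  ∑ e ∈ p.support.filter (fun e => ¬ BlockMem S e), monomial e (coeff e p)

/-- The coefficients of the standard part. -/
theorem coeff_stdPart (S : Finset (Fin n)) (p : MvPolynomial (Fin n) K) (e : Fin n →₀ ℕ) :
    coeff e (stdPart S p) = if BlockMem S e then 0 else coeff e p := by
  classical
  rw [stdPart, coeff_sum]
  simp_rw [coeff_monomial]
  rw [Finset.sum_ite_eq']
  simp only [Finset.mem_filter, mem_support_iff]
  by_cases h : BlockMem S e
  · simp [h]
  · by_cases h' : coeff e p = 0 <;> simp [h, h']

/-- The monomials of the standard part are standard (not in `I_S`). -/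
theorem not_blockMem_of_mem_support_stdPart {S : Finset (Fin n)} {p : MvPolynomial (Fin n) K} {e : Fin n →₀ ℕ}
    (h : e ∈ (stdPart S p).support) : ¬ BlockMem S e := by
  intro he
  rw [mem_support_iff, coeff_stdPart, if_pos he] at h
  exact h rfl

/-- `stdPart S p ≡ p (mod I_S)`. -/
theorem stdPart_sub_mem (S : Finset (Fin n)) (p : MvPolynomial (Fin n) K) : stdPart S p - p ∈ blockIdeal K S := by
  rw [mem_blockIdeal_iff]
  intro e he
  by_contra hne
  rw [mem_support_iff, coeff_sub, coeff_stdPart, if_neg hne, sub_self] at he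
  exact he rfl

/-- `stdPart S p` and `p` have the same class in `R/I_S`. -/
theorem mk_stdPart (S : Finset (Fin n)) (p : MvPolynomial (Fin n) K) :
    Ideal.Quotient.mk (blockIdeal K S) (stdPart S p) = Ideal.Quotient.mk (blockIdeal K S) p :=
  (Ideal.Quotient.eq).2 (stdPart_sub_mem S p)

/-- A polynomial all of whose monomials are standard and which lies in `I_S` is zero. -/
theorem eq_zero_of_std_of_mem {S : Finset (Fin n)} {p : MvPolynomial (Fin n) K}
    (hstd : ∀ e ∈ p.support, ¬ BlockMem S e) (hp : p ∈ blockIdeal K S) : p = 0 := by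
  rw [mem_blockIdeal_iff] at hp
  ext e
  rw [coeff_zero]
  by_contra hne
  exact hstd e (mem_support_iff.2 hne) (hp e (mem_support_iff.2 hne))

/-- The standard part of an element of `I_S` vanishes. -/
theorem stdPart_eq_zero {S : Finset (Fin n)} {p : MvPolynomial (Fin n) K} (hp : p ∈ blockIdeal K S) :
    stdPart S p = 0 := by
  refine eq_zero_of_std_of_mem (fun e he => not_blockMem_of_mem_support_stdPart he) ?_
  have := Ideal.add_mem _ (stdPart_sub_mem S p) hp
  rwa [sub_add_cancel] at this

/-- Two polynomials with the same class have the same standard part. -/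
theorem stdPart_eq_of_mk_eq {S : Finset (Fin n)} {p q : MvPolynomial (Fin n) K}
    (h : Ideal.Quotient.mk (blockIdeal K S) p = Ideal.Quotient.mk (blockIdeal K S) q) : stdPart S p = stdPart S q := by
  rw [Ideal.Quotient.eq, mem_blockIdeal_iff] at h
  ext e
  rw [coeff_stdPart, coeff_stdPart]
  split_ifs with he
  · rfl
  · by_contra hne
    apply he
    apply h
    rw [mem_support_iff, coeff_sub]
    exact sub_ne_zero.2 hne

/-- Multiplying a standard polynomial by a free coordinate `x_c`, `c ∉ S`, keeps it standard. -/
theorem std_X_mul {S : Finset (Fin n)} {c : Fin n} (hc : c ∉ S) {q : MvPolynomial (Fin n) K}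
    (hq : ∀ e ∈ q.support, ¬ BlockMem S e) : ∀ e ∈ (X c * q).support, ¬ BlockMem S e := by
  classical
  intro e he
  rw [support_X_mul, Finset.mem_map] at he
  obtain ⟨e', he', rfl⟩ := he
  change ¬ BlockMem S (Finsupp.single c 1 + e')
  rw [blockMem_single_add_iff_of_notMem hc]
  exact hq e' he'

/-- The difference of two standard polynomials is standard. -/
theorem std_sub {S : Finset (Fin n)} {p q : MvPolynomial (Fin n) K} (hp : ∀ e ∈ p.support, ¬ BlockMem S e)
    (hq : ∀ e ∈ q.support, ¬ BlockMem S e) : ∀ e ∈ (p - q).support, ¬ BlockMem S e := by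
  classical
  intro e he
  rcases Finset.mem_union.1 (support_sub (σ := Fin n) p q he) with h | h
  · exact hp e h
  · exact hq e h

/-- **Free coordinates divide exactly.**  If `y = x_c • z` in `R/I_S` with `c ∉ S`, then every monomial of the standard
part of (any representative of) `y` is divisible by `x_c`. -/
theorem apply_ne_zero_of_mk_eq_X_smul {S : Finset (Fin n)} {c : Fin n} (hc : c ∉ S) {g h : MvPolynomial (Fin n) K}
    (hgh : Ideal.Quotient.mk (blockIdeal K S) g = (X c : MvPolynomial (Fin n) K) • Ideal.Quotient.mk (blockIdeal K S) h)
    {e : Fin n →₀ ℕ} (he : e ∈ (stdPart S g).support) : e c ≠ 0 := by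
  classical
  have hg : ∀ e ∈ (stdPart S g).support, ¬ BlockMem S e := fun e he => not_blockMem_of_mem_support_stdPart he
  have hh : ∀ e ∈ (X c * stdPart S h).support, ¬ BlockMem S e :=
    std_X_mul hc fun e he => not_blockMem_of_mem_support_stdPart he
  have h1 : stdPart S g = X c * stdPart S h := by
    have hmem : stdPart S g - X c * stdPart S h ∈ blockIdeal K S := by
      rw [← Ideal.Quotient.eq, mk_stdPart, ← smul_mk_eq, mk_stdPart, hgh]
    exact sub_eq_zero.1 (eq_zero_of_std_of_mem (std_sub hg hh) hmem)
  rw [h1, support_X_mul, Finset.mem_map] at he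
  obtain ⟨e', -, rfl⟩ := he
  simp only [addLeftEmbedding_apply, Finsupp.coe_add, Pi.add_apply, Finsupp.single_eq_same]
  omega

/-- **Free square-free factors are non-zero-divisors on `R/I_S`**: `x_T • y = 0`, `T ∩ S = ∅` ⟹ `y = 0`. -/
theorem eq_zero_of_sq_smul_eq_zero {S T : Finset (Fin n)} (hT : Disjoint T S)
    {y : MvPolynomial (Fin n) K ⧸ blockIdeal K S} (h : (sq T : MvPolynomial (Fin n) K) • y = 0) : y = 0 := by
  obtain ⟨g, rfl⟩ := Ideal.Quotient.mk_surjective y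
  rw [← mk_stdPart, Ideal.Quotient.eq_zero_iff_mem]
  rw [← mk_stdPart, smul_mk_eq, Ideal.Quotient.eq_zero_iff_mem] at h
  have hstd : ∀ e ∈ (sq T * stdPart S g).support, ¬ BlockMem S e := by
    intro e he
    obtain ⟨hle, hmem⟩ := le_of_mem_support_sq_mul he
    have : e = (e - ind T) + ind T := (tsub_add_cancel_of_le hle).symm
    rw [this, blockMem_add_ind_iff_of_disjoint hT]
    exact not_blockMem_of_mem_support_stdPart hmem
  rw [eq_zero_of_sq_mul_eq_zero (eq_zero_of_std_of_mem hstd h)]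
  exact Submodule.zero_mem _

/-! ## STEP A for a block with free coordinates -/

/-- **Step A (block form).**  If `x_a ν_a = x_b ν_b` in `R/I_S` for all `a, b ∈ S`, then `x_a ν_a = 0` for every `a ∈ S`
(a monomial of `x_a g` with a zero exponent at `b ∈ S` is untouched by `x_b g'`, hence lies in `I_S`). -/
theorem X_smul_eq_zero_of_forall_X_smul_eq {S : Finset (Fin n)}
    (ν : ↥S → MvPolynomial (Fin n) K ⧸ blockIdeal K S)
    (h : ∀ a b : ↥S, (X a.1 : MvPolynomial (Fin n) K) • ν a = (X b.1 : MvPolynomial (Fin n) K) • ν b)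
    (a : ↥S) : (X a.1 : MvPolynomial (Fin n) K) • ν a = 0 := by
  classical
  obtain ⟨g, hg⟩ := Ideal.Quotient.mk_surjective (ν a)
  rw [← hg, smul_mk_eq, Ideal.Quotient.eq_zero_iff_mem, mem_blockIdeal_iff]
  intro e he
  by_cases hfull : ∀ l ∈ S, l ∈ e.support
  · exact ⟨a.1, a.2, fun l hl => hfull l (mem_erase.1 hl).2⟩
  push Not at hfull
  obtain ⟨b, hbS, hb⟩ := hfull
  obtain ⟨g', hg'⟩ := Ideal.Quotient.mk_surjective (ν ⟨b, hbS⟩)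
  have hmem : X a.1 * g - X b * g' ∈ blockIdeal K S := by
    rw [← Ideal.Quotient.eq, ← smul_mk_eq, ← smul_mk_eq, hg, hg']
    exact h a ⟨b, hbS⟩
  have hcoeff : coeff e (X a.1 * g - X b * g') = coeff e (X a.1 * g) := by
    rw [coeff_sub, coeff_X_mul' e b g', if_neg hb, sub_zero]
  have he' : e ∈ (X a.1 * g - X b * g').support := by
    rw [mem_support_iff, hcoeff]
    exact mem_support_iff.1 he
  exact mem_blockIdeal_iff.1 hmem e he'

end Summit.Ventures.HSemireg.ObstructionLocus.BlockModel
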